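import Literature.NumberTheory.EllipticCurves.Kato2004.ZetaBodyLayerValuesProofs
import Literature.NumberTheory.EllipticCurves.Kato2004.LayerCharacterCuspFactorProofs
import Literature.NumberTheory.EllipticCurves.CyclotomicZpExtensionLayerTorsionProofs
import Literature.NumberTheory.EllipticCurves.RohrlichNonvanishingProofs
import HarnessLib

/-!
# Kato 2004 (Astérisque 295): an ADMISSIBLE zeta class is NON-ZERO, given Rohrlich's non-vanishing theorem
# for the twists of `p`-power conductor (THEOREMS ONLY; K-CUT-2 input (a), kernel part 2c = assembly)

Topic `NumberTheory/EllipticCurves`, sub-directory `Kato2004` (namespace = path). THEOREMS ONLY (net debt 0): no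
`def … : Prop`, no named fact, no instance, no notation, no `sorry`. Seat `bsd-cm-prr-ty1` (literature-prover, cell
`bsd-cm`; stub 4 `stub_realizableOfKMCFine` of the Kato–Perrin-Riou skeletons on cruxes stmt-BirchSwinnertonDyer-19945 /
-19223, residue (i) «admissible `z₀ ≠ 0`»). HONEST FRAMING: BSD is not proved by any of this; nothing about Kato's Main
Conjecture or Perrin-Riou's conjecture is asserted; the statement is CONDITIONAL on an admissible class given as a
hypothesis and on Rohrlich's theorem given as a hypothesis `hR` IN THE EXACT SHAPE of the tree's theorems
`Rohrlich1984_nonvanishing_twists.primePow_of_isNewformOf` (`RohrlichNonvanishingProofs`, `p ∤ N`) and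
`Summit.BirchSwinnertonDyer.BirchSwinnertonDyer.Theorems.PSRohrlichAtLevel.rohrlich_primePow_of_isNewformOf` (any `p`;
a `Summits/` file, hence not importable here — the consumer feeds it: `hR := fun hf ↦ rohrlich_primePow_of_isNewformOf hf`).

## What

`IsAdmissibleZetaClass.ne_zero_of_rohrlich`: for `p` odd (part of admissibility), `(K, γ)` the cyclotomic
`ℤ_p`-extension with a topological generator, `I : IwasawaH1Data W p K γ` with `T_pW` free of finite rank, an admissible
zeta class `z₀ ∈ 𝐇¹` (`Kato2004/AdmissibleZetaClass.lean`) is `≠ 0` as soon as, for the newform `f` of `W`, only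
finitely many primitive Dirichlet characters of `p`-power conductor have `L(f, χ, 1) = 0` (Rohrlich).

## The argument (assembly of parts 1, 2a, 2b; Kato Thm. 12.5 (1) ⇐ Thm. 12.4 + Rohrlich, p. 222: "by a theorem of
## Rohrlich … `L(f, χ, 1) ≠ 0` for almost all characters `χ` of `Gal(ℚ(ζ_{p^∞})/ℚ)` … hence `𝐳_γ ∉ 𝔭·𝐇¹`")

Suppose `z₀ = 0`. Part 1 (`IsAdmissibleZetaClass.exists_forall_value_eq_zero_of_eq_zero`, `ZetaBodyLayerValuesProofs`)
gives the witnessing data `p ≠ 2`, `f`, guarded `(c, d₁, a, A, d′)` with `R⁻_𝟙 ≠ 0`, and the vanishing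
`Lχ(1) · R⁻_χ̄(c, d₁, a, A, d′) = 0` at EVERY layer `n`, for every even character `χ mod p^{n+1}` killing the image of
`Gal(ℚ̄/ℚ_n)` and every entire continuation `Lχ` of the `p^{n+1}·pA`-depleted twisted series. Part 2a
(`LayerCharacter.exists_layerCharacter_cuspFactor_ne_zero`, `LayerCharacterCuspFactorProofs`) gives `n₀` such that
every level `p^{n+1}`, `n ≥ n₀`, carries a LAYER character `χ` (kernel exactly `Δ = μ_{p−1}`) with `R⁻_χ̄ ≠ 0`; such a
`χ` is even, primitive of conductor `p^{n+1}` (`n ≥ 1`), and kills the image of `Gal(ℚ̄/ℚ_n)` (part 2b,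
`ZpExtension.IsCyclotomic.dirichletCharacter_apply_eq_one_of_mem_layerSubgroup`). Rohrlich's exceptional set is
finite, so its levels are bounded by some `B`; at `n = n₀ + B + 1` the level `p^{n+1} > B` is not exceptional, so the
entire continuation `L₀` of `L(f, χ, s)` (Shimura, `exists_differentiable_eq_twistedLSeries_holds`) has `L₀(1) ≠ 0`,
and the depleted continuation `L = (∏ Euler factors) · L₀` has `L(1) ≠ 0` (`exists_continuation_changeLevel_of`:
the removed Euler factors of an elliptic curve do not vanish at `s = 1`). Then `L(1) · R⁻_χ̄ ≠ 0` contradicts part 1.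

## Source

K. Kato, Astérisque 295 (2004) [Kato2004Asterisque]: Thm. 12.5 (1) and its proof from Thm. 12.4 (2) [pp. 221–222],
§13.8 [p. 228], Thm. 6.6 (1) [p. 163]; D. E. Rohrlich, Invent. Math. 75 (1984), Theorem p. 409
[RohrlichInventiones1984] (entering as the hypothesis `hR`); L. C. Washington, *Introduction to Cyclotomic Fields*
§13.1 [Washington1997]. Nothing beyond these readings (all already of record in the three imported files) is used.
-/

set_option autoImplicit false

noncomputable section

open scoped BigOperators NumberField
open Field CongruenceSubgroup
open Literature.NumberTheory.GaloisRepresentations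
open Literature.NumberTheory.EllipticCurves Literature.NumberTheory.EllipticCurves.ModularForms
open Literature.NumberTheory.EllipticCurves.Kato2004.EulerSystemValues

namespace Literature.NumberTheory.EllipticCurves.Kato2004

section Admissible

variable {W : WeierstrassCurve ℚ} [W.IsElliptic] [W.IsGloballyMinimal] {p : ℕ} [hp : Fact p.Prime]
  [ContinuousSMul ℤ_[p] (W.tateModule p)] {K : ZpExtension ℚ p} {hK : K.IsCyclotomic}
  {γ : absoluteGaloisGroup ℚ} {I : IwasawaH1Data W p K γ} {z₀ : I.H}

omit hp in
/-- The guard `(c, 6pA) = 1` of Kato's parameters gives `(|c|, p) = 1`. [cite: Kato2004Asterisque, Ex. 13.3 (p. 225)] -/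
theorem natAbs_coprime_of_gcd_six_mul_eq_one {c : ℤ} {A : ℕ} (hc : Int.gcd c (6 * p * A) = 1) :
    c.natAbs.Coprime p := by
  have h1 : IsCoprime c (p : ℤ) :=
    ((Int.isCoprime_iff_gcd_eq_one.mpr hc).of_mul_right_left).of_mul_right_right
  have h2 := Int.isCoprime_iff_gcd_eq_one.mp h1
  simpa [Int.gcd_eq_natAbs] using h2

/-- **An admissible zeta class is non-zero, given Rohrlich's theorem for the newform of `W` at `p`.** For an
admissible `z₀ ∈ 𝐇¹_Γ(T_pW)` (`IsAdmissibleZetaClass W p K hK I z₀`: `p` odd, `f` the newform of `W`, Kato's zeta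
family with guarded parameters and `R⁻_𝟙 ≠ 0`, the position clause (A6′)) and `γ` a topological generator: if for
the newform `f` of `W` only finitely many primitive Dirichlet characters `χ` of `p`-power conductor have an entire
continuation of `L(f, χ, s)` vanishing at `s = 1` (Rohrlich 1984 — the hypothesis `hR`, stated in the exact shape
of `Rohrlich1984_nonvanishing_twists.primePow_of_isNewformOf` / `PSRohrlichAtLevel.rohrlich_primePow_of_isNewformOf`,
which discharge it for `p ∤ N` resp. every `p`), then `z₀ ≠ 0`. This is the step "`L(f, χ, 1) ≠ 0` for almost all
characters `χ` of `Gal(ℚ(ζ_{p^∞})/ℚ)` [Ro1] ⇒ the zeta element is not zero (indeed not divisible)" of Kato's proof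
of Thm. 12.5 from Thm. 12.4. [cite: Kato2004Asterisque, Thm. 12.5 (1) and proof (pp. 221–222), Thm. 12.4 (2) (p. 221)] -/
theorem IsAdmissibleZetaClass.ne_zero_of_rohrlich [Module.Free ℤ_[p] (W.tateModule p)]
    [Module.Finite ℤ_[p] (W.tateModule p)] (h : IsAdmissibleZetaClass W p K hK I z₀)
    (hγ : K.IsTopGenerator γ)
    (hR : ∀ {N : ℕ} [NeZero N] {f : CuspForm (Gamma0 N) 2}, IsNewformOf W f →
      Set.Finite {χ : Σ m : ℕ, DirichletCharacter ℂ m |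
        χ.1 ≠ 0 ∧ χ.1.primeFactors ⊆ {p} ∧ χ.2.IsPrimitive ∧
          ∃ L : ℂ → ℂ, Differentiable ℂ L ∧
            (∀ s : ℂ, 2 < s.re → L s = twistedLSeries f χ.2 s) ∧ L 1 = 0}) :
    z₀ ≠ 0 := by
  intro hz
  obtain ⟨hp2, N, _, f, hf, c, d₁, a, A, d', hA, hc, hd, -, hRne, hval⟩ :=
    h.exists_forall_value_eq_zero_of_eq_zero hγ hz
  -- part 2a: a level `n₀` beyond which every `p^{n+1}` carries a layer character with `R⁻_χ̄ ≠ 0`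
  obtain ⟨n₀, hn₀⟩ := LayerCharacter.exists_layerCharacter_cuspFactor_ne_zero f hp2
    (natAbs_coprime_of_gcd_six_mul_eq_one hc) (natAbs_coprime_of_gcd_six_mul_eq_one hd) a A d' hRne
  -- Rohrlich: the exceptional levels are bounded by some `B`
  obtain ⟨B, hB⟩ := ((hR hf).image Sigma.fst).bddAbove
  -- the level `M = p^{n+1}`, `n = n₀ + B + 1`
  have hn₀n : n₀ ≤ n₀ + B + 1 := by omega
  have h1n : 1 ≤ n₀ + B + 1 := by omega
  have hBn : B < p ^ (n₀ + B + 1 + 1) :=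
    lt_of_lt_of_le (by omega) (Nat.lt_pow_self hp.out.one_lt).le
  have hM : cycLevel p (n₀ + B + 1 + 1) ∅ = p ^ (n₀ + B + 1 + 1) := by simp [cycLevel]
  obtain ⟨χ, hker, hcusp⟩ := hn₀ (n₀ + B + 1) hn₀n (M := cycLevel p (n₀ + B + 1 + 1) ∅) hM
  have heven : χ (-1) = 1 := LayerCharacter.apply_neg_one hp2 hker
  have hprim : χ.IsPrimitive := LayerCharacter.isPrimitive h1n hM hker
  have hlayer : ∀ σ ∈ K.layerSubgroup (n₀ + B + 1),
      χ ((modNCyclotomicCharacter ℚ (cycLevel p (n₀ + B + 1 + 1) ∅) σ :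
          (ZMod (cycLevel p (n₀ + B + 1 + 1) ∅))ˣ) : ZMod (cycLevel p (n₀ + B + 1 + 1) ∅)) = 1 :=
    fun σ hσ => hK.dirichletCharacter_apply_eq_one_of_mem_layerSubgroup hp2 (n₀ + B + 1) hM χ
      (fun b hb => (hker b).mpr hb) hσ
  -- Shimura: an entire continuation `L₀` of `L(f, χ, s)`; Rohrlich off the exceptional levels: `L₀ 1 ≠ 0`
  obtain ⟨L₀, hL₀d, hL₀s⟩ :=
    exists_differentiable_eq_twistedLSeries_holds f (m := cycLevel p (n₀ + B + 1 + 1) ∅) χ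
  have hL₀1 : L₀ 1 ≠ 0 := by
    intro h0
    have hle : cycLevel p (n₀ + B + 1 + 1) ∅ ≤ B := by
      refine hB ⟨⟨cycLevel p (n₀ + B + 1 + 1) ∅, χ⟩, ?_, rfl⟩
      refine ⟨NeZero.ne _, ?_, hprim, L₀, hL₀d, hL₀s, h0⟩
      change (cycLevel p (n₀ + B + 1 + 1) ∅).primeFactors ⊆ {p}
      rw [hM, Nat.primeFactors_prime_pow (Nat.succ_ne_zero _) hp.out]
    rw [hM] at hle
    exact absurd hle (not_le.mpr hBn)
  -- the depleted continuation at level `p^{n+1}·(pA)` does not vanish at `1` (Euler factors of `W` at `s = 1`)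
  haveI : NeZero (cycLevel p (n₀ + B + 1 + 1) ∅ * (p * A)) :=
    ⟨mul_ne_zero (NeZero.ne _) (mul_ne_zero hp.out.ne_zero hA.ne')⟩
  obtain ⟨L, hLd, hLs, hL1⟩ := exists_continuation_changeLevel_of hf
    (dvd_mul_right (cycLevel p (n₀ + B + 1 + 1) ∅) (p * A)) χ ⟨L₀, hL₀d, hL₀s, hL₀1⟩
  have hdep : IsDepletedTwistedL f (cycLevel p (n₀ + B + 1 + 1) ∅) (p * A) χ L := ⟨hLd, hLs⟩
  -- part 1: but every such layer value vanishes when `z₀ = 0`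
  exact mul_ne_zero hL1 hcusp (hval (n₀ + B + 1) χ hlayer heven L hdep)

/-- **Corollary: `𝐇¹` is non-trivial** (the input of `Kato2004.one_le_rank_iwasawaH1_of_nontrivial`: rank `𝐇¹ ≥ 1`).
[cite: Kato2004Asterisque, Thm. 12.4 (2)–(3) (p. 221)] -/
theorem IsAdmissibleZetaClass.nontrivial_of_rohrlich [Module.Free ℤ_[p] (W.tateModule p)]
    [Module.Finite ℤ_[p] (W.tateModule p)] (h : IsAdmissibleZetaClass W p K hK I z₀)
    (hγ : K.IsTopGenerator γ)
    (hR : ∀ {N : ℕ} [NeZero N] {f : CuspForm (Gamma0 N) 2}, IsNewformOf W f →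
      Set.Finite {χ : Σ m : ℕ, DirichletCharacter ℂ m |
        χ.1 ≠ 0 ∧ χ.1.primeFactors ⊆ {p} ∧ χ.2.IsPrimitive ∧
          ∃ L : ℂ → ℂ, Differentiable ℂ L ∧
            (∀ s : ℂ, 2 < s.re → L s = twistedLSeries f χ.2 s) ∧ L 1 = 0}) :
    Nontrivial I.H :=
  ⟨⟨z₀, 0, h.ne_zero_of_rohrlich hγ hR⟩⟩

/-- **The good-reduction case, unconditionally in `Literature`**: if the newform level `N` of the admissibility
witness may be taken prime to `p` — phrased without naming `N`: Rohrlich's finiteness holds for EVERY newform of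
`W` of level prime to `p` ⇒ it is the tree's theorem `Rohrlich1984_nonvanishing_twists.primePow_of_isNewformOf` —
then `z₀ ≠ 0` as soon as every newform of `W` has level prime to `p`. [cite: RohrlichInventiones1984, Theorem (p. 409)] -/
theorem IsAdmissibleZetaClass.ne_zero_of_forall_not_dvd_level [Module.Free ℤ_[p] (W.tateModule p)]
    [Module.Finite ℤ_[p] (W.tateModule p)] (h : IsAdmissibleZetaClass W p K hK I z₀)
    (hγ : K.IsTopGenerator γ)
    (hN : ∀ {N : ℕ} [NeZero N] {f : CuspForm (Gamma0 N) 2}, IsNewformOf W f → ¬ p ∣ N) :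
    z₀ ≠ 0 :=
  h.ne_zero_of_rohrlich hγ fun hf => Rohrlich1984_nonvanishing_twists.primePow_of_isNewformOf hf (hN hf)

end Admissible

end Literature.NumberTheory.EllipticCurves.Kato2004

end
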